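import Summits.ValiantsHypothesis.ValiantsHypothesis.Theses.ContractivityPrice

/-!
# `StabilisedPerZeroFree` — the stabilised permanent is zero-free on the radius-2 polydisc

Route `route-ValiantsHypothesis-ContractivityPrice`, item `stmt-ValiantsHypothesis-10586` (support).

`Q_n(z) = per_n(I + z/(4n))` has no zero on the closed polydisc of radius `2`.  Writing
`Q_n(z) = per(1 + W)` with `W i j = z (i, j) / (4n)`, so that `‖W i j‖ ≤ 1/(2n)`, the subset
expansion `per(1 + W) = ∑_T ∑_{σ fixing Tᶜ pointwise} ∏_{i ∈ T} W (σ i) i` (expand each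
`∏ᵢ (W + δ)_{σ i, i}` with `Finset.prod_add`; the `δ`-product selects the permutations fixing the
complement of `T`, counted by `card_perms_of_finset`) gives
`‖per(1 + W) − 1‖ ≤ ∑_{k ≥ 1} C(n,k) · k! · (2n)^{-k} ≤ ∑_{k=1}^{n} 2^{-k} < 1`
(`C(n,k) k! = n.descFactorial k ≤ n^k`).
-/

-- `Summit.<Summit>.<Problem>` repeats `ValiantsHypothesis` by the tree's layout convention (D-0017).
set_option linter.dupNamespace false

namespace Summit.ValiantsHypothesis.ValiantsHypothesis.Theorems

open Finset Matrix Equiv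

/-- Subset expansion of `per(1 + W)`: expand every `∏ᵢ (W (σ i) i + δ (σ i) i)` over the set `T`
of indices taking the `W`-factor, and swap the two sums. -/
theorem stabPer_permanent_one_add_eq_sum_powerset {n : ℕ} (W : Matrix (Fin n) (Fin n) ℂ) :
    (1 + W).permanent = ∑ T ∈ (univ : Finset (Fin n)).powerset, ∑ σ : Perm (Fin n),
      (∏ i ∈ T, W (σ i) i) * ∏ i ∈ univ \ T, (1 : Matrix (Fin n) (Fin n) ℂ) (σ i) i := by
  unfold Matrix.permanent
  rw [Finset.sum_comm]
  refine Finset.sum_congr rfl fun σ _ => ?_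
  simp only [Matrix.add_apply]
  rw [← Finset.prod_add]
  exact Finset.prod_congr rfl fun i _ => add_comm _ _

/-- For a fixed index set `T`, the `δ`-product over the complement of `T` is the indicator of the
permutations fixing `Tᶜ` pointwise. -/
theorem stabPer_prod_one_apply_sdiff {n : ℕ} (T : Finset (Fin n)) (σ : Perm (Fin n)) :
    ∏ i ∈ univ \ T, (1 : Matrix (Fin n) (Fin n) ℂ) (σ i) i = if ∀ i ∉ T, σ i = i then 1 else 0 := by
  split_ifs with h
  · refine Finset.prod_eq_one fun i hi => ?_
    rw [h i (Finset.mem_sdiff.1 hi).2, Matrix.one_apply_eq]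
  · push Not at h
    obtain ⟨i, hi, hne⟩ := h
    exact Finset.prod_eq_zero (Finset.mem_sdiff.2 ⟨mem_univ _, hi⟩) (Matrix.one_apply_ne hne)

/-- The permutations of `Fin n` fixing the complement of `T` pointwise are `#T !` in number
(`permsOfFinset T`). -/
theorem stabPer_card_filter_fix_compl {n : ℕ} (T : Finset (Fin n)) :
    #(univ.filter fun σ : Perm (Fin n) => ∀ i ∉ T, σ i = i) = (#T).factorial := by
  rw [← card_perms_of_finset T]
  congr 1
  ext σ
  simp only [Finset.mem_filter, Finset.mem_univ, true_and, mem_perms_of_finset_iff]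
  constructor
  · intro h x hx
    by_contra hxT
    exact hx (h x hxT)
  · intro h x hxT
    by_contra hx
    exact hxT (h hx)

/-- Norm bound for the `T`-term of the subset expansion: if `‖W i j‖ ≤ c` then
`‖∑_σ (∏_{i ∈ T} W (σ i) i) · [σ fixes Tᶜ]‖ ≤ #T ! · c ^ #T`. -/
theorem stabPer_norm_term_le {n : ℕ} (W : Matrix (Fin n) (Fin n) ℂ) {c : ℝ}
    (hW : ∀ i j, ‖W i j‖ ≤ c) (T : Finset (Fin n)) :
    ‖∑ σ : Perm (Fin n), (∏ i ∈ T, W (σ i) i) * ∏ i ∈ univ \ T, (1 : Matrix (Fin n) (Fin n) ℂ) (σ i) i‖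
      ≤ ((#T).factorial : ℝ) * c ^ #T := by
  calc ‖∑ σ : Perm (Fin n), (∏ i ∈ T, W (σ i) i) * ∏ i ∈ univ \ T, (1 : Matrix (Fin n) (Fin n) ℂ) (σ i) i‖
      ≤ ∑ σ : Perm (Fin n), ‖(∏ i ∈ T, W (σ i) i) * ∏ i ∈ univ \ T, (1 : Matrix (Fin n) (Fin n) ℂ) (σ i) i‖ :=
        norm_sum_le _ _
    _ ≤ ∑ σ : Perm (Fin n), (if ∀ i ∉ T, σ i = i then c ^ #T else 0) := by
        refine Finset.sum_le_sum fun σ _ => ?_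
        rw [stabPer_prod_one_apply_sdiff]
        split_ifs with h
        · rw [mul_one, norm_prod]
          calc ∏ i ∈ T, ‖W (σ i) i‖ ≤ ∏ i ∈ T, c :=
                Finset.prod_le_prod (fun i _ => norm_nonneg _) fun i _ => hW _ _
            _ = c ^ #T := Finset.prod_const c
        · simp
    _ = (#(univ.filter fun σ : Perm (Fin n) => ∀ i ∉ T, σ i = i) : ℝ) * c ^ #T := by
        rw [Finset.sum_ite, Finset.sum_const_zero, add_zero, Finset.sum_const, nsmul_eq_mul]
    _ = ((#T).factorial : ℝ) * c ^ #T := by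
        rw [stabPer_card_filter_fix_compl]

/-- The `T = ∅` term of the subset expansion is `per(1) = 1`. -/
theorem stabPer_term_empty {n : ℕ} (W : Matrix (Fin n) (Fin n) ℂ) :
    ∑ σ : Perm (Fin n), (∏ i ∈ (∅ : Finset (Fin n)), W (σ i) i) *
      ∏ i ∈ univ \ ∅, (1 : Matrix (Fin n) (Fin n) ℂ) (σ i) i = 1 := by
  have h := (Matrix.permanent_one : Matrix.permanent (1 : Matrix (Fin n) (Fin n) ℂ) = 1)
  unfold Matrix.permanent at h
  simpa using h

/-- General estimate: if every entry of `W` has norm at most `c`, then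
`‖per(1 + W) − 1‖ ≤ ∑_{k=0}^{n} C(n,k) · k! · c^k − 1 = ∑_{k=1}^{n} C(n,k) · k! · c^k`. -/
theorem stabPer_norm_permanent_one_add_sub_one_le {n : ℕ} (W : Matrix (Fin n) (Fin n) ℂ) {c : ℝ}
    (hW : ∀ i j, ‖W i j‖ ≤ c) :
    ‖(1 + W).permanent - 1‖ ≤
      (∑ k ∈ Finset.range (n + 1), (n.choose k : ℝ) * ((k.factorial : ℝ) * c ^ k)) - 1 := by
  rw [stabPer_permanent_one_add_eq_sum_powerset]
  have hmem : (∅ : Finset (Fin n)) ∈ (univ : Finset (Fin n)).powerset := Finset.empty_mem_powerset _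
  rw [← Finset.add_sum_erase _ _ hmem, stabPer_term_empty W, add_sub_cancel_left]
  have hcard := Finset.sum_powerset_apply_card (fun k => ((k.factorial : ℝ) * c ^ k))
    (x := (univ : Finset (Fin n)))
  simp only [Finset.card_univ, Fintype.card_fin, nsmul_eq_mul] at hcard
  calc ‖∑ T ∈ (univ.powerset).erase ∅, ∑ σ : Perm (Fin n),
          (∏ i ∈ T, W (σ i) i) * ∏ i ∈ univ \ T, (1 : Matrix (Fin n) (Fin n) ℂ) (σ i) i‖
      ≤ ∑ T ∈ (univ.powerset).erase ∅, ‖∑ σ : Perm (Fin n),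
          (∏ i ∈ T, W (σ i) i) * ∏ i ∈ univ \ T, (1 : Matrix (Fin n) (Fin n) ℂ) (σ i) i‖ :=
        norm_sum_le _ _
    _ ≤ ∑ T ∈ (univ.powerset).erase ∅, (((#T).factorial : ℝ) * c ^ #T) :=
        Finset.sum_le_sum fun T _ => stabPer_norm_term_le W hW T
    _ = (∑ T ∈ (univ : Finset (Fin n)).powerset, (((#T).factorial : ℝ) * c ^ #T)) -
          (((#(∅ : Finset (Fin n))).factorial : ℝ) * c ^ #(∅ : Finset (Fin n))) := by
        rw [Finset.sum_erase_eq_sub hmem]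
    _ = (∑ k ∈ Finset.range (n + 1), (n.choose k : ℝ) * ((k.factorial : ℝ) * c ^ k)) - 1 := by
        rw [hcard]
        simp

/-- Numerics: for `n ≥ 1` and `c = 1/(2n)`,
`∑_{k=0}^{n} C(n,k) · k! · c^k − 1 ≤ ∑_{k=0}^{n} 2^{-k} − 1 = 1 − 2^{-n} < 1`
(`C(n,k) · k! = n.descFactorial k ≤ n ^ k`). -/
theorem stabPer_numeric_bound {n : ℕ} (hn : 1 ≤ n) :
    (∑ k ∈ Finset.range (n + 1), (n.choose k : ℝ) * ((k.factorial : ℝ) * (1 / (2 * n)) ^ k)) - 1 < 1 := by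
  have hn' : (0 : ℝ) < n := by exact_mod_cast hn
  have hle : ∀ k ∈ Finset.range (n + 1),
      (n.choose k : ℝ) * ((k.factorial : ℝ) * (1 / (2 * n)) ^ k) ≤ (1 / 2) ^ k := by
    intro k _
    have h1 : (n.choose k : ℝ) * k.factorial = n.descFactorial k := by
      rw [Nat.descFactorial_eq_factorial_mul_choose]; push_cast; ring
    have h2 : (n.descFactorial k : ℝ) ≤ (n : ℝ) ^ k := by
      exact_mod_cast Nat.descFactorial_le_pow n k
    calc (n.choose k : ℝ) * ((k.factorial : ℝ) * (1 / (2 * n)) ^ k)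
        = (n.descFactorial k : ℝ) * (1 / (2 * n)) ^ k := by rw [← h1]; ring
      _ ≤ (n : ℝ) ^ k * (1 / (2 * n)) ^ k := by gcongr
      _ = (1 / 2) ^ k := by
        rw [← mul_pow]
        congr 1
        field_simp
  have hgeom : ∑ k ∈ Finset.range (n + 1), ((1 : ℝ) / 2) ^ k < 2 := by
    rw [geom_sum_eq (by norm_num) (n + 1), div_lt_iff_of_neg (by norm_num)]
    have hp : (0 : ℝ) < (1 / 2) ^ (n + 1) := by positivity
    linarith
  have := Finset.sum_le_sum hle
  linarith

/-- `StabilisedPerZeroFree` (route `ContractivityPrice`, item `stmt-ValiantsHypothesis-10586`):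
`Q_n(z) = per_n(I + z/(4n))` does not vanish when all `‖z e‖ ≤ 2`.  The value is
`per(1 + W)` with `W i j = z (i, j) / (4n)`, `‖W i j‖ ≤ 1/(2n)`, and
`‖per(1 + W) − 1‖ < 1` by `stabPer_norm_permanent_one_add_sub_one_le` and
`stabPer_numeric_bound`; for `n = 0` the permanent of the empty matrix is `1`. -/
theorem stabilisedPerZeroFree_proof :
    Summit.ValiantsHypothesis.ValiantsHypothesis.Theses.ContractivityPrice.StabilisedPerZeroFree := by
  unfold Summit.ValiantsHypothesis.ValiantsHypothesis.Theses.ContractivityPrice.StabilisedPerZeroFree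
  intro n z hz
  have hval : MvPolynomial.eval z (MvPolynomial.aeval
      (fun e : Fin n × Fin n => MvPolynomial.C (if e.1 = e.2 then (1 : ℂ) else 0) +
        MvPolynomial.C ((4 * (n : ℂ))⁻¹) * MvPolynomial.X e)
      (Literature.Computability.AlgebraicComplexity.perPoly (Fin n) ℂ)) =
      (1 + Matrix.of fun i j : Fin n => (4 * (n : ℂ))⁻¹ * z (i, j)).permanent := by
    simp only [Literature.Computability.AlgebraicComplexity.perPoly, Matrix.permanent, map_sum,
      map_prod, Matrix.mvPolynomialX_apply, MvPolynomial.aeval_X, map_add, map_mul,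
      MvPolynomial.eval_C, MvPolynomial.eval_X,
      Matrix.add_apply, Matrix.one_apply, Matrix.of_apply]
  rw [hval]
  rcases Nat.eq_zero_or_pos n with rfl | hn
  · rw [Matrix.permanent_isEmpty]
    exact one_ne_zero
  · have hWb : ∀ i j, ‖(Matrix.of fun i j : Fin n => (4 * (n : ℂ))⁻¹ * z (i, j)) i j‖ ≤ 1 / (2 * n) := by
      intro i j
      have hn' : (0 : ℝ) < n := by exact_mod_cast hn
      have h4 : ‖(4 * (n : ℂ))⁻¹‖ = (4 * (n : ℝ))⁻¹ := by simp [norm_inv]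
      rw [Matrix.of_apply, norm_mul, h4]
      calc (4 * (n : ℝ))⁻¹ * ‖z (i, j)‖ ≤ (4 * (n : ℝ))⁻¹ * 2 := by gcongr; exact hz _
        _ = 1 / (2 * n) := by field_simp; ring
    have key := stabPer_norm_permanent_one_add_sub_one_le _ hWb
    have hlt := stabPer_numeric_bound hn
    intro h0
    rw [h0, zero_sub, norm_neg, norm_one] at key
    linarith

end Summit.ValiantsHypothesis.ValiantsHypothesis.Theorems
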